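import Summits.ResolutionOfSingularities.ResolutionOfSingularities.Theorems.FrobeniusLadderFInjectiveMacaulayficationGradedChartClause
import Summits.ResolutionOfSingularities.ResolutionOfSingularities.Theorems.FrobeniusLadderFInjectiveMacaulayficationGradedEngineOfChartClause
import HarnessLib

/-!
# G6 `stub_e8GradedFiModel`: `E₈⁰` in one weighted step at `p = 2, 3, 5` (crux `FInjectiveMacaulayfication`, §16)

Proof file for the registered stub G6 `stub_e8GradedFiModel` of crux stmt-ResolutionOfSingularities-15315
(`FrobeniusLadder.FInjectiveMacaulayfication`), skeleton v11 `86e9127b`, §16 THE GRADED ENGINE (CRUX-PLAN w45a v3; lead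
seat res-L1-w45a-lead-1). [OURS · L1 W4.5a]

Over every field of characteristic `2`, `3` or `5` the surface `X₂² + X₀³ + X₁⁵ = 0` admits the crux's model (proper
birational, locally integral, Cohen–Macaulay with Frobenius closed parameter ideals) by the SINGLE weighted blow-up
`affineBlowup I₃₀` (weights `(10, 6, 15)`) of its only bad point — where towers of point blow-ups need `4`, `2`, `1`
steps (survey j023222, p156147, p139106) and the μ-cover engine of §15 is silent (its cover charts fail, tri-1 F1).
Proof: G4 `GradedChartClause.stub_gradedChartClause` (p488482) fed into the landed implication
`GradedEngineOfChartClause.e8GradedFiModel_of_gradedChartClause` (G4 ⇒ G6: `E8WeightedData` p466953 — homogeneity,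
Veronese saturation for `N = 30`, off-origin clause at `p = 2, 3, 5` — and `E8Forms` p137855).
No definitions, no named facts. [folklore]
-/

set_option linter.dupNamespace false

open AlgebraicGeometry CategoryTheory Literature.AlgebraicGeometry.Resolution

namespace Summit.ResolutionOfSingularities.ResolutionOfSingularities.Theorems.FInjectiveMacaulayfication.E8GradedFiModel

open Summit.ResolutionOfSingularities.ResolutionOfSingularities.Theorems.FInjectiveMacaulayfication

/-- G6 **`E₈⁰` IN ONE WEIGHTED STEP AT `p = 2, 3, 5`** (registered stub `stub_e8GradedFiModel`): over every field of
characteristic `2`, `3` or `5` the surface `X₂² + X₀³ + X₁⁵ = 0` admits a proper birational model all of whose stalks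
are domains satisfying the per-stalk clause of the crux, by the single weighted blow-up `affineBlowup I₃₀` (weights
`(10,6,15)`) — G4 through `e8GradedFiModel_of_gradedChartClause`. [folklore] -/
theorem stub_e8GradedFiModel : ∀ (p : ℕ) [Fact p.Prime], (p = 2 ∨ p = 3 ∨ p = 5) → ∀ (k : Type) [Field k] [CharP k p]
    (f : MvPolynomial (Fin 3) k), f = MvPolynomial.X 2 ^ 2 + MvPolynomial.X 0 ^ 3 + MvPolynomial.X 1 ^ 5 →
    ∃ (X' : Scheme.{0}) (π : X' ⟶ Spec (.of (MvPolynomial (Fin 3) k ⧸ Ideal.span {f}))), IsProper π ∧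
      Literature.AlgebraicGeometry.Resolution.IsBirational π ∧
      ∀ y : X', IsDomain (X'.presheaf.stalk y) ∧ ∀ d : ℕ, ringKrullDim (X'.presheaf.stalk y) = d →
        ∀ s : Fin d → X'.presheaf.stalk y, (Ideal.span (Set.range s)).radical.IsMaximal →
          RingTheory.Sequence.IsWeaklyRegular (X'.presheaf.stalk y) (List.ofFn s) ∧
          ∀ z : X'.presheaf.stalk y, (∃ e : ℕ, z ^ p ^ e ∈
              Ideal.span ((fun w : X'.presheaf.stalk y => w ^ p ^ e) ''
                (Ideal.span (Set.range s) : Set (X'.presheaf.stalk y)))) →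
            z ∈ Ideal.span (Set.range s) :=
  GradedEngineOfChartClause.e8GradedFiModel_of_gradedChartClause GradedChartClause.stub_gradedChartClause

end Summit.ResolutionOfSingularities.ResolutionOfSingularities.Theorems.FInjectiveMacaulayfication.E8GradedFiModel
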